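import Summits.BirchSwinnertonDyer.Rank1Residual.X2.AnalyticInvariants
import Summits.BirchSwinnertonDyer.Rank1Residual.X2.RankZero
import HarnessLib

/-!
# Class X2 (odd multiplicative Eisenstein prime): Mazur's main conjecture at a pair WITHOUT
# λ-EXCESS — `μ_an = 0 ∧ λ_an = r_an + e ⇒ MC at (E,p)`, ranks `0` AND `1`
# (cell `b2b-bsdres`, unit `b2b-bsdres-eisenstein-p2`, gen 4)

HONEST FRAMING (run/shared/lean/b2b/bsd-rank1-residual/, verbatim in every file): the goal of the
cell is to DELETE the COMBINATION-SHAPED residual classes of the Birch–Swinnerton-Dyer formula for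
ALL analytic-rank `≤ 1` elliptic curves over `ℚ` — "full BSD formula for every rank `≤ 1` curve in
class `C`" assembled STRICTLY from published theorems — so that the rank-`≤ 1` remainder becomes
exactly the CONSTRUCTION-SHAPED classes, which are TYPED (missing-input `Prop`s), NOT attempted.
This is not "finishing BSD". Research routes; NO CLAIM BEYOND STATED CLASSES; nothing here changes
a label; X2b and X2c stay CONSTRUCTION-SHAPED. Theorems only (no definition, no named fact): the
published theorems enter as the tree's existing NAMED FACTS, taken as hypotheses.

WHY THIS FILE. The parity squeeze of `X2/ParitySqueeze.lean` (route P) handles λ-excess `2` in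
rank `0`. The DEGENERATE case — no λ-excess at all — needs neither Greenberg's Prop. 3.10 nor the
Euler-characteristic formula, and works in RANK `1` as well: with Wuthrich's integral divisibility
`ϖ·L = ι(T^e·h·f_E)` (`char_Λ X = (f_E)`, Doc. Math. 19 (2014) Thm. 16, multiplicative clauses,
`E[p]` reducible, `p` odd) and Jones's order-of-vanishing clause `T^{rank E(ℚ)} ∣ f_E`
(Stein–Wuthrich 2013 Thm. 6.1 (1)), the count `λ(T^e·h·f_E) = e + λ(h) + λ(f_E) = e + r_an`
together with `λ(f_E) ≥ rank E(ℚ) = r_an` (Gross–Zagier–Kolyvagin) forces `λ(h) = 0`, and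
`μ(h) ≤ μ(ϖ·L) = 0`; so `h ∈ Λˣ` — Mazur's main conjecture at `(E,p)` in the tree's shape
`X2.MazurMainConjectureAt W p` (Greenberg–Vatsal, Invent. Math. 142 (2000) p. 4: "the equality
`λ_alg = λ_an` … the further equality `μ_alg = μ_an` then implies the Main Conjecture"; here both
equalities are READ OFF two finite `p`-adic checks).

* `mazurMainConjectureAt_of_lamMin` — `W` globally minimal, `p ≠ 2` multiplicative, `E[p]`
  reducible, `r_an ≤ 1`, `X2.AnalyticMuLE W p 0`, and `X2.AnalyticLambdaEq W p (r_an + e)`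
  (`e = 1` split / `0` non-split, as two hypotheses) ⇒ `X2.MazurMainConjectureAt W p`.
* rank `0`: `bsdp_of_lamMin_rankZero` (`BSD(E,p)` via gen 1). Rank `1`: the conclusion is the
  CYCLOTOMIC main conjecture at an X2c pair — a statement in print for no class of multiplicative
  Eisenstein pairs (Keller–Yin 2024 Thm. 5.0.4 is the ANTICYCLOTOMIC one, PRE); `BSD(E,p)` at such a
  pair still needs the `p`-adic regulator (lever L3, `Typed.X2.bsdp_of_thm16mult_*_of_certificate`)
  and is NOT claimed here.
Census reach (iw-2, IWASAWA-CENSUS part II §4.4, N < 2·10⁴, two engines): X2 pairs with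
λ_an − (r + e) = 0: rank 0 — 330 split + 87 non-split @3, 14 + 10 @5; rank 1 — 365 split + 88
non-split @3, 31 + 2 @5 (= 486 of the 705 X2c pairs). Nothing booked; candidates for the referee.

References: [GreenbergVatsal2000] (1)–(2), p. 4; [Wuthrich2014] Thm. 16, §5 (p. 397);
[SteinWuthrich2013] Thm. 6.1 (1); HOME/b2b-bsdres-eisenstein-p2/X2-GAP.md §9.
-/

set_option autoImplicit false

noncomputable section

open scoped Classical MatrixGroups ModularForm

open PowerSeries CongruenceSubgroup WeierstrassCurve Literature.NumberTheory.EllipticCurves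
  Literature.NumberTheory.EllipticCurves.ModularForms
  Literature.NumberTheory.EllipticCurves.Rank1Residual
  Literature.NumberTheory.EllipticCurves.Rank1Residual.Typed
  Literature.NumberTheory.EllipticCurves.Wuthrich2014
  Literature.NumberTheory.EllipticCurves.SteinWuthrich2013
  Summit.BirchSwinnertonDyer.Rank1Residual.X1.MuLambda
  Summit.BirchSwinnertonDyer.Rank1Residual.X1.MuPart
  Summit.BirchSwinnertonDyer.Rank1Residual.X1.ParitySqueeze

namespace Summit.BirchSwinnertonDyer.Rank1Residual.X2

/-! ## §1. Algebra: the degenerate squeeze -/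

section Algebra

variable {p : ℕ} [Fact p.Prime]

/-- **The squeeze without excess (pure algebra).** `u, h, f ∈ Λ` nonzero, `λ(u) = k`,
`μ(u·h·f) = 0`, `λ(u·h·f) = k + r` and `r ≤ λ(f)` ⇒ `h ∈ Λˣ` and `λ(f) = r`, `μ(f) = 0`
(additivity of `μ` and `λ`). [cite: GreenbergVatsal2000, p. 4 (after Thm. (1.2))] -/
theorem isUnit_of_lam_mul_mul_eq_of_le {u h f : IwasawaAlgebra p} {k r : ℕ} (hu : u ≠ 0)
    (hh : h ≠ 0) (hf : f ≠ 0) (hlu : lam u = k) (hμ : mu (u * (h * f)) = 0)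
    (hl : lam (u * (h * f)) = k + r) (hr : r ≤ lam f) : IsUnit h ∧ lam f = r ∧ mu f = 0 := by
  obtain ⟨-, hμh, hμf⟩ := mu_eq_zero_of_mu_mul_mul_eq_zero hu hh hf hμ
  rw [lam_mul hu (mul_ne_zero hh hf), lam_mul hh hf, hlu] at hl
  have hlf : lam f = r := by omega
  have hlh : lam h = 0 := by omega
  exact ⟨(isUnit_iff_mu_eq_zero_and_lam_eq_zero h).mpr ⟨hh, hμh, hlh⟩, hlf, hμf⟩

/-- `T^r ∣ f`, `f ≠ 0 ⇒ r ≤ λ(f)` (`λ(T) = 1`, additivity). [folklore] -/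
theorem le_lam_of_X_pow_dvd {f : IwasawaAlgebra p} {r : ℕ} (hf : f ≠ 0)
    (hdvd : (PowerSeries.X : IwasawaAlgebra p) ^ r ∣ f) : r ≤ lam f := by
  obtain ⟨f₁, rfl⟩ := hdvd
  have hX0 : (PowerSeries.X : IwasawaAlgebra p) ≠ 0 := PowerSeries.X_ne_zero
  have hXr : (PowerSeries.X : IwasawaAlgebra p) ^ r ≠ 0 := pow_ne_zero r hX0
  have hf₁ : f₁ ≠ 0 := fun h0 ↦ hf (by rw [h0, mul_zero])
  rw [lam_mul hXr hf₁, lam_pow hX0, lam_X, mul_one]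
  exact Nat.le_add_right r _

/-- A series with a coefficient of norm `> p^{-(m+1)}` is nonzero. [folklore] -/
theorem ne_zero_of_lt_norm_coeff {L : PowerSeries ℚ_[p]} {m k : ℕ}
    (h : (p : ℝ) ^ (-((m : ℤ) + 1)) < ‖PowerSeries.coeff k L‖) : L ≠ 0 := by
  rintro rfl
  rw [map_zero, norm_zero] at h
  exact not_le.mpr h (by positivity)

end Algebra

/-! ## §2. `μ_an = 0 ∧ λ_an = r_an + e ⇒` Mazur's main conjecture at `(E,p)`, `r_an ≤ 1` -/

section LamMin

variable {W : WeierstrassCurve ℚ} [W.IsElliptic] [W.IsGloballyMinimal] {p : ℕ} [Fact p.Prime]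

/-- **No λ-excess ⇒ Mazur's main conjecture at an odd multiplicative Eisenstein prime, analytic
rank `≤ 1`.** Data: `W/ℚ` globally minimal elliptic, `p ≠ 2` of multiplicative reduction, `E[p]`
reducible, `r_an = ord_{s=1}L(E,s) ≤ 1`. PUBLISHED named facts (hypotheses): Wuthrich 2014
Thm. 16 (`hWu`: `X` torsion, `ϖ·L = ι(T^e·g)`, `g ∈ char_Λ X`), Stein–Wuthrich 2013 Thm. 6.1
clause (1) `T^{rank E(ℚ)} ∣ f_E` with THE §4.2 heights (`hJs hJn hHs hHn`; only the order-of-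
vanishing clause is used), Gross–Zagier–Kolyvagin (`hGZK`: `rank E(ℚ) = r_an`). Per-pair data:
`AnalyticMuLE W p 0` and `AnalyticLambdaEq W p (r_an + e)` (`hlamN` at a non-split prime, `e = 0`;
`hlamS` at a split prime, `e = 1`: the trivial zero counts). Conclusion:
`X2.MazurMainConjectureAt W p`. Proof: `char X = (f_E)`, `g = h·f_E`,
`e + λ(h) + λ(f_E) = λ(T^e·h·f_E) = e + r_an`, `λ(f_E) ≥ rank = r_an`, so `λ(h) = 0`; `μ(h) = 0`;
`h ∈ Λˣ`. Neither Prop. 3.10 nor the Euler-characteristic formula is needed.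
[cite: GreenbergVatsal2000, p. 4 (after Thm. (1.2))] [cite: Wuthrich2014, Thm. 16 and §5 (p. 397)]
[cite: SteinWuthrich2013, Thm. 6.1 (p. 20), clause (1)] -/
theorem mazurMainConjectureAt_of_lamMin
    (hWu : thm16_charIdeal_dvd_multiplicative_of_reducible)
    (hJs : thm61_splitMultiplicative) (hJn : thm61_nonsplitMultiplicative)
    (hHs : exists_isSplitMultCanonical) (hHn : exists_isMultCanonical)
    (hGZK : rank_eq_analyticRank_of_analyticRank_le_one)
    (W : WeierstrassCurve ℚ) [W.IsElliptic] [W.IsGloballyMinimal] (p : ℕ) [Fact p.Prime]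
    (hp2 : p ≠ 2) (hmult : W.HasMultiplicativeReductionAtPrime p)
    (hred : ¬ W.HasIrreducibleModPGaloisRep p) (hr : W.analyticRank ≤ 1)
    (hμ0 : AnalyticMuLE W p 0)
    (hlamN : ¬ W.HasSplitMultiplicativeReductionAtPrime p → AnalyticLambdaEq W p W.analyticRank)
    (hlamS : W.HasSplitMultiplicativeReductionAtPrime p →
      AnalyticLambdaEq W p (W.analyticRank + 1)) :
    X2.MazurMainConjectureAt W p := by
  intro κ γ hκ hγ hγ' N _ f hf D ϖ hϖ
  haveI : Module.Finite (IwasawaAlgebra p) D.X := D.module_finite_holds hγ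
  -- Wuthrich Thm. 16 at this datum; a generator `fE` of the characteristic ideal
  obtain ⟨hX, hKns, hKs⟩ := hWu W p hp2 hmult hred hκ hγ hγ' hf D ϖ hϖ
  haveI : (Literature.NumberTheory.EllipticCurves.Module.charIdeal (IwasawaAlgebra p) D.X).IsPrincipal :=
    charIdeal_isPrincipal_holds p D.X
  obtain ⟨fE, hfE⟩ := Submodule.IsPrincipal.principal
    (Literature.NumberTheory.EllipticCurves.Module.charIdeal (IwasawaAlgebra p) D.X)
  have hchar : D.charIdeal = Ideal.span {fE} := hfE
  -- Gross–Zagier–Kolyvagin: `rank E(ℚ) = r_an`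
  obtain ⟨hrank, -⟩ := hGZK W hr
  -- Jones clause (1): `T^{rank} ∣ fE`, hence `r_an ≤ λ(fE)` once `fE ≠ 0`
  have hdvd : (PowerSeries.X : IwasawaAlgebra p) ^ W.analyticRank ∣ fE := by
    rw [← hrank]
    by_cases hsplit : W.HasSplitMultiplicativeReductionAtPrime p
    · obtain ⟨Dq⟩ := (nonempty_tateParameterData_iff_holds (W := W) (p := p)).mpr hsplit
      obtain ⟨Dh, hDh⟩ := hHs W p hp2 Dq
      exact thm61_splitMultiplicative.X_pow_dvd hJs hp2 Dq hκ hγ hγ' D hX hDh hchar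
    · obtain ⟨q, ⟨hq0, hq1, hqj⟩, -⟩ := existsUnique_tateJ_eq_of_one_lt_norm
        (one_lt_norm_j_of_hasMultiplicativeReductionAtPrime (W := W) (p := p) hmult)
      obtain ⟨Dh, hDh⟩ := hHn W p hp2 hmult hsplit q hq0 hq1 hqj
      exact thm61_nonsplitMultiplicative.X_pow_dvd hJn hp2 hmult hsplit hq0 hq1 hqj hκ hγ hγ' D hX
        hDh hchar
  -- how the analytic certificates at `G = u · (h · fE)` finish
  have finish : ∀ (u h g : IwasawaAlgebra p) (k : ℕ) (L : PowerSeries ℚ_[p]), u ≠ 0 → lam u = k →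
      h * fE = g → iwasawaToPowerSeries p (u * (h * fE)) = PowerSeries.C ((ϖ : ℚ) : ℚ_[p]) * L →
      (∃ k' : ℕ, (p : ℝ) ^ (-(((0 : ℕ) : ℤ) + 1)) <
        ‖PowerSeries.coeff k' (PowerSeries.C ((ϖ : ℚ) : ℚ_[p]) * L)‖) →
      lam (u * (h * fE)) = k + W.analyticRank → IsUnit h := by
    intro u h g k L hu0 hlu hgh hG hμ hlG
    obtain ⟨k', hk'⟩ := hμ
    have hL0 : PowerSeries.C ((ϖ : ℚ) : ℚ_[p]) * L ≠ 0 := ne_zero_of_lt_norm_coeff hk'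
    have hG0 : u * (h * fE) ≠ 0 := by
      intro h0; apply hL0; rw [← hG, h0, map_zero]
    have hh0 : h ≠ 0 := fun h0 ↦ hG0 (by rw [h0, zero_mul, mul_zero])
    have hfE0 : fE ≠ 0 := fun h0 ↦ hG0 (by rw [h0, mul_zero, mul_zero])
    rw [← hG] at hk'
    have hμG : mu (u * (h * fE)) = 0 := Nat.le_zero.mp (mu_le_of_lt_norm_coeff hk')
    exact (isUnit_of_lam_mul_mul_eq_of_le hu0 hh0 hfE0 hlu hμG hlG
      (le_lam_of_X_pow_dvd hfE0 hdvd)).1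
  refine ⟨hX, fE, hchar, fun hsplit L hL => ?_, fun hns L hL => ?_⟩
  · -- SPLIT `p`: `ι(T · g) = ϖ · L`, `g = h · fE`, `λ(T·h·fE) = 1 + r_an`
    obtain ⟨g, hgmem, hιg⟩ := hKs hsplit L hL
    have hgmem' : g ∈ Ideal.span {fE} := by rw [← hchar]; exact hgmem
    obtain ⟨h, hgh⟩ := Ideal.mem_span_singleton'.mp hgmem'
    have hG : iwasawaToPowerSeries p (PowerSeries.X * (h * fE)) =
        PowerSeries.C ((ϖ : ℚ) : ℚ_[p]) * L := by rw [hgh]; exact hιg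
    have hlG : lam (PowerSeries.X * (h * fE)) = 1 + W.analyticRank := by
      rw [add_comm]
      exact hlamS hsplit f hf ϖ hϖ L (fun _ ↦ hL) (fun hns ↦ absurd hsplit hns) _ hG
    have hunit : IsUnit h := finish PowerSeries.X h g 1 L PowerSeries.X_ne_zero lam_X hgh hG
      (hμ0 f hf ϖ hϖ L (fun _ ↦ hL) (fun hns ↦ absurd hsplit hns)) hlG
    refine ⟨hunit.unit, ?_⟩
    rw [IsUnit.unit_spec, show (PowerSeries.X : IwasawaAlgebra p) * fE * h = PowerSeries.X * g by
      rw [← hgh]; ring]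
    exact hιg
  · -- NON-SPLIT `p`: `ι(g) = ϖ · L`, `g = h · fE`, `λ(1·h·fE) = r_an`
    obtain ⟨g, hgmem, hιg⟩ := hKns hns L hL
    have hgmem' : g ∈ Ideal.span {fE} := by rw [← hchar]; exact hgmem
    obtain ⟨h, hgh⟩ := Ideal.mem_span_singleton'.mp hgmem'
    have hG : iwasawaToPowerSeries p (1 * (h * fE)) = PowerSeries.C ((ϖ : ℚ) : ℚ_[p]) * L := by
      rw [one_mul, hgh]; exact hιg
    have hlG : lam (1 * (h * fE)) = 0 + W.analyticRank := by
      rw [zero_add]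
      exact hlamN hns f hf ϖ hϖ L (fun hsplit ↦ absurd hsplit hns) (fun _ ↦ hL) _ hG
    have hunit : IsUnit h := finish 1 h g 0 L one_ne_zero (lam_eq_zero_of_isUnit isUnit_one) hgh hG
      (hμ0 f hf ϖ hϖ L (fun hsplit ↦ absurd hsplit hns) (fun _ ↦ hL)) hlG
    refine ⟨hunit.unit, ?_⟩
    rw [IsUnit.unit_spec, show fE * h = g by rw [← hgh]; ring]
    exact hιg

/-- **Rank `0`, no λ-excess: `μ_an = 0 ∧ λ_an = e ⇒ BSD(E,p)`** at an odd multiplicative Eisenstein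
prime (through gen 1's `bsdp_of_mazurMainConjectureAt_of_analyticRank_eq_zero`; Greenberg–Stevens
`hGS`, modularity `hmod hpar`). At such a pair `char_Λ X = Λ` (`X(E/ℚ_∞)` finite).
[cite: GreenbergVatsal2000, p. 4] [cite: Wuthrich2014, Thm. 16 (p. 397)] [cite: SteinWuthrich2013, Thm. 6.1 (p. 20)] -/
theorem bsdp_of_lamMin_rankZero
    (hWu : thm16_charIdeal_dvd_multiplicative_of_reducible)
    (hJs : thm61_splitMultiplicative) (hJn : thm61_nonsplitMultiplicative)
    (hHs : exists_isSplitMultCanonical) (hHn : exists_isMultCanonical)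
    (hGZK : rank_eq_analyticRank_of_analyticRank_le_one) (hmod : hasEntireLFunction_rat)
    (hpar : nonempty_modularParametrizationData)
    (W : WeierstrassCurve ℚ) [W.IsElliptic] [W.IsGloballyMinimal] (p : ℕ) [Fact p.Prime]
    (hGS : greenberg_stevens (W := W) (p := p))
    (hp2 : p ≠ 2) (hmult : W.HasMultiplicativeReductionAtPrime p)
    (hred : ¬ W.HasIrreducibleModPGaloisRep p) (hr : W.analyticRank = 0)
    (hμ0 : AnalyticMuLE W p 0)
    (hlamN : ¬ W.HasSplitMultiplicativeReductionAtPrime p → AnalyticLambdaEq W p 0)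
    (hlamS : W.HasSplitMultiplicativeReductionAtPrime p → AnalyticLambdaEq W p 1) : BSDp W p :=
  bsdp_of_mazurMainConjectureAt_of_analyticRank_eq_zero hJs hJn hHs hHn hGZK hmod hpar W p hGS hp2
    hmult hr
    (mazurMainConjectureAt_of_lamMin hWu hJs hJn hHs hHn hGZK W p hp2 hmult hred (by omega) hμ0
      (fun hns ↦ by rw [hr]; exact hlamN hns) (fun hs ↦ by rw [hr]; exact hlamS hs))

/-- **Rank `1` (sub-cell X2c), no λ-excess: `μ_an = 0 ∧ λ_an = 1 + e ⇒` the CYCLOTOMIC main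
conjecture at the pair** — `X2.MazurMainConjectureAt W p` on `CellC W p` from the two finite checks
(non-split `λ_an = 1`, split `λ_an = 2`). Main-conjecture instances at multiplicative Eisenstein
primes in rank one; `BSD(E,p)` is NOT claimed (it needs the `p`-adic regulator, lever L3).
[cite: GreenbergVatsal2000, p. 4] [cite: Wuthrich2014, Thm. 16 (p. 397)] [cite: SteinWuthrich2013, Thm. 6.1 (p. 20), clause (1)] -/
theorem cellC_mazurMainConjectureAt_of_lamMin
    (hWu : thm16_charIdeal_dvd_multiplicative_of_reducible)
    (hJs : thm61_splitMultiplicative) (hJn : thm61_nonsplitMultiplicative)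
    (hHs : exists_isSplitMultCanonical) (hHn : exists_isMultCanonical)
    (hGZK : rank_eq_analyticRank_of_analyticRank_le_one)
    (W : WeierstrassCurve ℚ) [W.IsElliptic] [W.IsGloballyMinimal] (p : ℕ) [Fact p.Prime]
    (hc : CellC W p) (hμ0 : AnalyticMuLE W p 0)
    (hlamN : ¬ W.HasSplitMultiplicativeReductionAtPrime p → AnalyticLambdaEq W p 1)
    (hlamS : W.HasSplitMultiplicativeReductionAtPrime p → AnalyticLambdaEq W p 2) :
    X2.MazurMainConjectureAt W p :=
  mazurMainConjectureAt_of_lamMin hWu hJs hJn hHs hHn hGZK W p hc.2.1 hc.2.2.2 hc.2.2.1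
    (by rw [hc.1]) hμ0 (fun hns ↦ by rw [hc.1]; exact hlamN hns)
    (fun hs ↦ by rw [hc.1]; exact hlamS hs)

/-- **Sub-cell X2b, no λ-excess: the typed missing input `X2.MissingInputB W p`** from `μ_an = 0`
and `λ_an = e` (non-split `0`, split `1`). [cite: GreenbergVatsal2000, p. 4] [cite: Wuthrich2014, Thm. 16 (p. 397)] -/
theorem missingInputB_of_cellB_of_lamMin
    (hWu : thm16_charIdeal_dvd_multiplicative_of_reducible)
    (hJs : thm61_splitMultiplicative) (hJn : thm61_nonsplitMultiplicative)
    (hHs : exists_isSplitMultCanonical) (hHn : exists_isMultCanonical)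
    (hGZK : rank_eq_analyticRank_of_analyticRank_le_one)
    (W : WeierstrassCurve ℚ) [W.IsElliptic] [W.IsGloballyMinimal] (p : ℕ) [Fact p.Prime]
    (hc : CellB W p) (hμ0 : AnalyticMuLE W p 0)
    (hlamN : ¬ W.HasSplitMultiplicativeReductionAtPrime p → AnalyticLambdaEq W p 0)
    (hlamS : W.HasSplitMultiplicativeReductionAtPrime p → AnalyticLambdaEq W p 1) :
    MissingInputB W p :=
  mazurMainConjectureAt_of_lamMin hWu hJs hJn hHs hHn hGZK W p hc.2.1.1 hc.2.1.2.2 hc.2.1.2.1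
    (by rw [hc.1]; omega) hμ0 (fun hns ↦ by rw [hc.1]; exact hlamN hns)
    (fun hs ↦ by rw [hc.1]; exact hlamS hs)

end LamMin

end Summit.BirchSwinnertonDyer.Rank1Residual.X2

end
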